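import Mathlib
import HarnessLib
import Summits.Ventures.LatticeQCDFlow.Exactness.SphereLOFlowL1Stability
import Summits.Ventures.LatticeQCDFlow.Exactness.LatticeBoundedDifferences
import Summits.Ventures.LatticeQCDFlow.Exactness.SphereFlowRelativeEntropy

/-!
# Volume scaling of the exact leading-order trivializing flow as an uncorrected sampler: the effective action concentrates with variance `≤ |Λ|·D²/4` and sub-Gaussian constant `|Λ|·D²/4`, the relative entropy to the target is `≤ |Λ|·D²/8` and the effective sample size is `≥ e^{−|Λ|·D²/2}`, `D = (12κ²υ²/(d−1))·c²·e^{3|κ|υc/(d−1)}` — per-site cost QUARTIC in the flow time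

HONEST FRAMING: exact (Metropolis-corrected) sampling algorithms for lattice gauge theory;
figures of merit are autocorrelation/cost numbers at stated couplings and volumes; no
continuum-physics claim.

Venture `LatticeQCDFlow` (cell pub-lqcd), topic `Exactness`; FANOUT row 7 (`s0-cpn-null`: the
S0-D1 rung — 2D CP⁹, Lüscher's LO trivializing map inside HMC, Engel–Schaefer 2011).  NEW WORK of
the cell over this leg's `Exactness/SphereLOFlowL1Stability.lean` (the effective action of the
exact LO flow has bounded differences `D`, uniformly in the volume) and
`Exactness/LatticeBoundedDifferences.lean` (McDiarmid's exponential-moment bound and the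
Efron–Stein–Popoviciu variance bound on a finite product of compact probability spaces), and
GEN-15's `Exactness/SphereFlowRelativeEntropy.lean` (`KL = E_π̄[S_eff] + log Z`) /
`Exactness/SphereLOFlowEffectiveAction.lean` (exact reweighting, the `e^{−(c²/2)M}` ESS bound);
nothing is cited as a fact.  Printed counterpart, NAMED ONLY: G. P. Engel, S. Schaefer, Comput.
Phys. Commun. 182 (2011) 2107, §3–§4 (the LO map as an approximate trivialization; its quality
degrades with the volume); M. Lüscher, Commun. Math. Phys. 293 (2010) 899, §3.  The volume law
"log(effective sample size) of a flow sampler with volume-independent per-site quality is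
extensive" is the cell's theory-2 / lean-2 `Scaling/` theme (`IMHVolumeLaw`, `KLVolumeLawPi`, for
PRODUCT proposals); THIS FILE proves the extensive UPPER bounds for a genuinely interacting,
non-product case — the exact leading-order flow of the lattice CP(N−1)/O(N) action — with the
correct FOURTH power of the flow time per site (GEN-15's bounds `(c²/2)·M` were second order and
extensive through `M = (2κ²/(d−1))Σ_n(Σ_m‖U_nm‖)²`).

## Setting

`E` finite-dimensional real inner product space, `d = dim E ≥ 2`; `Λ` finite; `π̄ = ⊗_Λ σ̄` the
uniform product law on `Ω = S(E)^Λ`; E–S couplings `U` (no self-coupling, adjoint pairs, local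
weight `Σ_m‖U_km‖ ≤ υ`); `S = esAction κ S₀ U`; `Φ_{0→c}` the exact flow of the constant generator
`S̃⁽⁰⁾ = loFlowAction κ S₀ U` (horizon `T`, `0 ≤ c ≤ |T| + 1`); the EFFECTIVE ACTION
`S_eff(ω) = c·S(Φ_{0→c}ω) − ℓ_{0→c}(ω)`; the importance weights `w = e^{−S_eff}` of the uncorrected
flow against `e^{−cS}π̄`; `K = 3|κ|υ/(d−1)`, `D = (12κ²υ²/(d−1))·c²·e^{Kc}`.

## Content

* `effAction_loFlow_bddDiff` — `S_eff` as a functional on `Ω` has bounded differences `D` (every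
  site, every volume); `continuous_effAction_loFlow`.
* **`variance_effAction_loFlow_le`** — `Var_π̄(S_eff) ≤ |Λ|·D²/4`: THE VARIANCE OF THE EFFECTIVE
  ACTION (= of the log-weights) IS AT MOST LINEAR IN THE VOLUME AND QUARTIC IN THE FLOW TIME.
* **`integral_exp_mul_effAction_loFlow_sub_le`** — `∫ e^{t(S_eff − E S_eff)} dπ̄ ≤ e^{t²|Λ|D²/8}`
  (McDiarmid): the log-weights are sub-Gaussian with variance proxy `|Λ|·D²/4`.
* **`toReal_klDiv_map_loFlow_le_volume`** — `KL((Φ_{0→c})_*π̄ ‖ e^{−cS}π̄/Z_c) ≤ |Λ|·D²/8`.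
* **`sq_integral_loWeight_ge_volume`** — `e^{−|Λ|·D²/2}·∫w² dπ̄ ≤ (∫w dπ̄)²`: THE EFFECTIVE SAMPLE
  SIZE FRACTION OF THE UNCORRECTED LO FLOW IS AT LEAST `exp(−|Λ|·D²/2)`, i.e. the reweighting cost
  per site is at most `D²/2 = 72κ⁴υ⁴c⁴e^{2Kc}/(d−1)²` nats — fourth order in the flow time, so at
  fixed per-site budget the admissible flow time scales like `|Λ|^{−1/4}` (vs `|Λ|^{−1/2}` from the
  second-order bound of GEN-15).

NOT CLAIMED: lower bounds on the variance / upper bounds on the ESS (the barrier direction);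
anything about the Metropolis-corrected chain's acceptance or autocorrelations; the one-step map
run by the rung; numbers of the rung.
-/

noncomputable section

namespace Summit.Ventures.LatticeQCDFlow.Exactness

open Function Set Metric MeasureTheory NormedSpace InnerProductSpace InformationTheory
open scoped RealInnerProductSpace Topology

variable {Λ : Type*} {E : Type*} [NormedAddCommGroup E] [InnerProductSpace ℝ E]
  [FiniteDimensional ℝ E] [Fintype Λ] [DecidableEq Λ] [MeasurableSpace E] [BorelSpace E] [Nontrivial E]
  {U : Λ → Λ → (E →L[ℝ] E)} {T : ℝ}

/-! ## §1 The effective action as a bounded-difference functional on `Ω` -/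

omit [MeasurableSpace E] [BorelSpace E] [Nontrivial E] in
/-- **`S_eff` is continuous on `Ω`.** -/
theorem continuous_effAction_loFlow (κ S₀ c : ℝ) :
    Continuous fun ω : Λ → sphere (0 : E) 1 =>
      c * esAction κ S₀ U (sphereTDFlow (G := fun _ : ℝ => loFlowAction κ S₀ U)
          (contDiff_const_family (contDiff_loFlowAction U κ S₀)) T 0 c (fun m => (ω m : E))) -
        sphereTDFlowLogJac (G := fun _ : ℝ => loFlowAction κ S₀ U)
          (contDiff_const_family (contDiff_loFlowAction U κ S₀)) T 0 c (fun m => (ω m : E)) := by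
  have h1 := (((contDiff_esAction U κ S₀ (m := 1)).comp (contDiff_sphereTDFlow_apply
    (G := fun _ : ℝ => loFlowAction κ S₀ U) (contDiff_const_family (contDiff_loFlowAction U κ S₀))
    0 c (T := T))).continuous).comp continuous_sphereConfig
  have h2 := continuous_sphereTDFlowLogJac_sphereConfig (G := fun _ : ℝ => loFlowAction κ S₀ U)
    (contDiff_const_family (contDiff_loFlowAction U κ S₀))
    (contDiff_const_family (contDiff_loFlowAction U κ S₀)) 0 c (T := T)
  exact (continuous_const.mul h1).sub h2

omit [MeasurableSpace E] [BorelSpace E] [Nontrivial E] in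
/-- **`S_eff` HAS BOUNDED DIFFERENCES `D = (12κ²υ²/(d−1))·c²·e^{Kc}` ON `Ω`**, `K = 3|κ|υ/(d−1)`,
at every site and in every volume. -/
theorem effAction_loFlow_bddDiff (hU0 : ∀ n, U n n = 0)
    (hUadj : ∀ m n (v w : E), ⟪U m n v, w⟫ = ⟪v, U n m w⟫) (hd : 2 ≤ Module.finrank ℝ E)
    (κ S₀ : ℝ) {υ : ℝ} (hυ : ∀ k, ∑ m, ‖U k m‖ ≤ υ) {c : ℝ} (hc0 : 0 ≤ c) (hc : c ≤ |T| + 1)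
    (ω : Λ → sphere (0 : E) 1) (k : Λ) (v v' : sphere (0 : E) 1) :
    (c * esAction κ S₀ U (sphereTDFlow (G := fun _ : ℝ => loFlowAction κ S₀ U)
          (contDiff_const_family (contDiff_loFlowAction U κ S₀)) T 0 c
            (fun m => ((update ω k v) m : E))) -
        sphereTDFlowLogJac (G := fun _ : ℝ => loFlowAction κ S₀ U)
          (contDiff_const_family (contDiff_loFlowAction U κ S₀)) T 0 c
            (fun m => ((update ω k v) m : E))) -
      (c * esAction κ S₀ U (sphereTDFlow (G := fun _ : ℝ => loFlowAction κ S₀ U)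
          (contDiff_const_family (contDiff_loFlowAction U κ S₀)) T 0 c
            (fun m => ((update ω k v') m : E))) -
        sphereTDFlowLogJac (G := fun _ : ℝ => loFlowAction κ S₀ U)
          (contDiff_const_family (contDiff_loFlowAction U κ S₀)) T 0 c
            (fun m => ((update ω k v') m : E))) ≤
      12 * κ ^ 2 * υ ^ 2 / ((Module.finrank ℝ E : ℝ) - 1) * c ^ 2 *
        Real.exp (3 * |κ| * υ / ((Module.finrank ℝ E : ℝ) - 1) * c) := by
  rw [sphereConfig_update, sphereConfig_update]
  set x : Λ → E := update (fun m => (ω m : E)) k (v : E) with hxdef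
  have hx : ∀ n, ‖x n‖ = 1 := by
    intro n
    by_cases hn : n = k
    · subst hn; rw [hxdef, update_self]; exact norm_eq_of_mem_sphere v
    · rw [hxdef, update_of_ne hn]; exact norm_sphereConfig_eq_one ω n
  have hxy : update (fun m => (ω m : E)) k (v' : E) = update x k (v' : E) := by
    rw [hxdef, update_idem]
  rw [hxy]
  exact (le_abs_self _).trans
    (abs_effAction_loFlow_update_sub_le hU0 hUadj hd κ S₀ hυ hx k (norm_eq_of_mem_sphere v') hc0 hc)

/-! ## §2 Variance and exponential moments of the effective action -/

/-- **THE VARIANCE OF THE EFFECTIVE ACTION OF THE EXACT LO FLOW IS AT MOST LINEAR IN THE VOLUME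
AND QUARTIC IN THE FLOW TIME**: `∫ (S_eff − ∫S_eff dπ̄)² dπ̄ ≤ |Λ|·D²/4`,
`D = (12κ²υ²/(d−1))·c²·e^{3|κ|υc/(d−1)}` (Efron–Stein + the bounded differences). -/
theorem variance_effAction_loFlow_le (hU0 : ∀ n, U n n = 0)
    (hUadj : ∀ m n (v w : E), ⟪U m n v, w⟫ = ⟪v, U n m w⟫) (hd : 2 ≤ Module.finrank ℝ E)
    (κ S₀ : ℝ) {υ : ℝ} (hυ : ∀ k, ∑ m, ‖U k m‖ ≤ υ) {c : ℝ} (hc0 : 0 ≤ c) (hc : c ≤ |T| + 1) :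
    ∫ ω, (c * esAction κ S₀ U (sphereTDFlow (G := fun _ : ℝ => loFlowAction κ S₀ U)
          (contDiff_const_family (contDiff_loFlowAction U κ S₀)) T 0 c
            (fun m => ((ω : Λ → sphere (0 : E) 1) m : E))) -
        sphereTDFlowLogJac (G := fun _ : ℝ => loFlowAction κ S₀ U)
          (contDiff_const_family (contDiff_loFlowAction U κ S₀)) T 0 c (fun m => (ω m : E)) -
        ∫ ω', (c * esAction κ S₀ U (sphereTDFlow (G := fun _ : ℝ => loFlowAction κ S₀ U)
          (contDiff_const_family (contDiff_loFlowAction U κ S₀)) T 0 c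
            (fun m => ((ω' : Λ → sphere (0 : E) 1) m : E))) -
          sphereTDFlowLogJac (G := fun _ : ℝ => loFlowAction κ S₀ U)
            (contDiff_const_family (contDiff_loFlowAction U κ S₀)) T 0 c (fun m => (ω' m : E)))
          ∂Measure.pi (fun _ : Λ => uniformSphere (volume : Measure E))) ^ 2
        ∂Measure.pi (fun _ : Λ => uniformSphere (volume : Measure E)) ≤
      Fintype.card Λ * (12 * κ ^ 2 * υ ^ 2 / ((Module.finrank ℝ E : ℝ) - 1) * c ^ 2 *
        Real.exp (3 * |κ| * υ / ((Module.finrank ℝ E : ℝ) - 1) * c)) ^ 2 / 4 := by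
  have h := variance_le_of_bddDiff (uniformSphere (volume : Measure E))
    (continuous_effAction_loFlow (U := U) κ S₀ c (T := T))
    (D := fun _ : Λ => 12 * κ ^ 2 * υ ^ 2 / ((Module.finrank ℝ E : ℝ) - 1) * c ^ 2 *
      Real.exp (3 * |κ| * υ / ((Module.finrank ℝ E : ℝ) - 1) * c))
    (fun ω k v v' => effAction_loFlow_bddDiff hU0 hUadj hd κ S₀ hυ hc0 hc ω k v v')
  simp only [Finset.sum_const, Finset.card_univ, nsmul_eq_mul] at h
  exact h

/-- **THE LOG-WEIGHTS OF THE EXACT LO FLOW ARE SUB-GAUSSIAN WITH AN EXTENSIVE, FOURTH-ORDER VARIANCE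
PROXY**: for every real `t`, `∫ exp(t·(S_eff − ∫S_eff dπ̄)) dπ̄ ≤ exp(t²·|Λ|·D²/8)` (McDiarmid). -/
theorem integral_exp_mul_effAction_loFlow_sub_le (hU0 : ∀ n, U n n = 0)
    (hUadj : ∀ m n (v w : E), ⟪U m n v, w⟫ = ⟪v, U n m w⟫) (hd : 2 ≤ Module.finrank ℝ E)
    (κ S₀ : ℝ) {υ : ℝ} (hυ : ∀ k, ∑ m, ‖U k m‖ ≤ υ) {c : ℝ} (hc0 : 0 ≤ c) (hc : c ≤ |T| + 1)
    (t : ℝ) :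
    ∫ ω, Real.exp (t * (c * esAction κ S₀ U (sphereTDFlow (G := fun _ : ℝ => loFlowAction κ S₀ U)
          (contDiff_const_family (contDiff_loFlowAction U κ S₀)) T 0 c
            (fun m => ((ω : Λ → sphere (0 : E) 1) m : E))) -
        sphereTDFlowLogJac (G := fun _ : ℝ => loFlowAction κ S₀ U)
          (contDiff_const_family (contDiff_loFlowAction U κ S₀)) T 0 c (fun m => (ω m : E)) -
        ∫ ω', (c * esAction κ S₀ U (sphereTDFlow (G := fun _ : ℝ => loFlowAction κ S₀ U)
          (contDiff_const_family (contDiff_loFlowAction U κ S₀)) T 0 c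
            (fun m => ((ω' : Λ → sphere (0 : E) 1) m : E))) -
          sphereTDFlowLogJac (G := fun _ : ℝ => loFlowAction κ S₀ U)
            (contDiff_const_family (contDiff_loFlowAction U κ S₀)) T 0 c (fun m => (ω' m : E)))
          ∂Measure.pi (fun _ : Λ => uniformSphere (volume : Measure E))))
        ∂Measure.pi (fun _ : Λ => uniformSphere (volume : Measure E)) ≤
      Real.exp (t ^ 2 * (Fintype.card Λ * (12 * κ ^ 2 * υ ^ 2 / ((Module.finrank ℝ E : ℝ) - 1) *
        c ^ 2 * Real.exp (3 * |κ| * υ / ((Module.finrank ℝ E : ℝ) - 1) * c)) ^ 2) / 8) := by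
  have h := mcdiarmid_integral_exp_le (uniformSphere (volume : Measure E))
    (continuous_effAction_loFlow (U := U) κ S₀ c (T := T))
    (D := fun _ : Λ => 12 * κ ^ 2 * υ ^ 2 / ((Module.finrank ℝ E : ℝ) - 1) * c ^ 2 *
      Real.exp (3 * |κ| * υ / ((Module.finrank ℝ E : ℝ) - 1) * c))
    (fun ω k v v' => effAction_loFlow_bddDiff hU0 hUadj hd κ S₀ hυ hc0 hc ω k v v') t
  simp only [Finset.sum_const, Finset.card_univ, nsmul_eq_mul] at h
  exact h

/-! ## §3 Relative entropy and effective sample size: extensive with a fourth-order rate -/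

/-- **THE RELATIVE ENTROPY OF THE EXACT LO FLOW IS AT MOST `|Λ|·D²/8`**:
`KL((Φ_{0→c})_*π̄ ‖ π̄.tilted(−cS)) ≤ |Λ|·(12κ²υ²/(d−1))²·c⁴·e^{2Kc}/8`
(`KL = E_π̄[S_eff] + log ∫e^{−S_eff} dπ̄` by the exact reweighting, and McDiarmid at `t = −1`). -/
theorem toReal_klDiv_map_loFlow_le_volume (hU0 : ∀ n, U n n = 0)
    (hUadj : ∀ m n (v w : E), ⟪U m n v, w⟫ = ⟪v, U n m w⟫) (hd : 2 ≤ Module.finrank ℝ E)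
    (κ S₀ : ℝ) {υ : ℝ} (hυ : ∀ k, ∑ m, ‖U k m‖ ≤ υ) {c : ℝ} (hc0 : 0 ≤ c) (hc : c ≤ |T| + 1) :
    (klDiv (Measure.map (sphereTDFlowMap (G := fun _ : ℝ => loFlowAction κ S₀ U)
          (contDiff_const_family (contDiff_loFlowAction U κ S₀)) T 0 c)
          (Measure.pi (fun _ : Λ => uniformSphere (volume : Measure E))))
        ((Measure.pi (fun _ : Λ => uniformSphere (volume : Measure E))).tilted
          fun ω => -(c * esAction κ S₀ U (fun m => (ω m : E))))).toReal ≤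
      Fintype.card Λ * (12 * κ ^ 2 * υ ^ 2 / ((Module.finrank ℝ E : ℝ) - 1) * c ^ 2 *
        Real.exp (3 * |κ| * υ / ((Module.finrank ℝ E : ℝ) - 1) * c)) ^ 2 / 8 := by
  have hc' : |c| ≤ |T| + 1 := by rwa [abs_of_nonneg hc0]
  have h0 : |(0 : ℝ)| ≤ |T| + 1 := by rw [abs_zero]; positivity
  rw [toReal_klDiv_map_sphereTDFlowMap_tilted _ (contDiff_const_family (contDiff_loFlowAction U κ S₀))
    (contDiff_esAction U κ S₀) c h0 hc']
  set μ : Measure (Λ → sphere (0 : E) 1) := Measure.pi (fun _ : Λ => uniformSphere (volume : Measure E))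
    with hμ
  set F : (Λ → sphere (0 : E) 1) → ℝ := fun ω =>
    c * esAction κ S₀ U (sphereTDFlow (G := fun _ : ℝ => loFlowAction κ S₀ U)
        (contDiff_const_family (contDiff_loFlowAction U κ S₀)) T 0 c (fun m => (ω m : E))) -
      sphereTDFlowLogJac (G := fun _ : ℝ => loFlowAction κ S₀ U)
        (contDiff_const_family (contDiff_loFlowAction U κ S₀)) T 0 c (fun m => (ω m : E)) with hF
  set A : ℝ := Fintype.card Λ * (12 * κ ^ 2 * υ ^ 2 / ((Module.finrank ℝ E : ℝ) - 1) * c ^ 2 *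
    Real.exp (3 * |κ| * υ / ((Module.finrank ℝ E : ℝ) - 1) * c)) ^ 2 with hA
  set m : ℝ := ∫ ω, F ω ∂μ with hm
  have hFc : Continuous F := continuous_effAction_loFlow (U := U) κ S₀ c (T := T)
  -- the partition function is `∫ e^{−S_eff} dπ̄` (exact reweighting with `H = 1`)
  have hZ : ∫ ω, Real.exp (-(c * esAction κ S₀ U (fun m => ((ω : Λ → sphere (0 : E) 1) m : E)))) ∂μ =
      ∫ ω, Real.exp (-F ω) ∂μ := by
    have hw := integral_loWeight_mul_comp_eq (U := U) κ S₀ (contDiff_const (c := (1 : ℝ))) hc' (T := T)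
    simp only [mul_one] at hw
    rw [hμ, ← hw]
    refine integral_congr_ae (ae_of_all _ fun ω => ?_)
    simp only [hF, neg_sub]
  -- McDiarmid at `t = −1`: `∫ e^{−F} ≤ e^{−m} e^{A/8}`
  have hMc := integral_exp_mul_effAction_loFlow_sub_le hU0 hUadj hd κ S₀ hυ hc0 hc (-1) (T := T)
  rw [← hμ] at hMc
  have hexp : ∫ ω, Real.exp (-F ω) ∂μ ≤ Real.exp (-m) * Real.exp (A / 8) := by
    have e : ∀ ω, Real.exp (-F ω) = Real.exp (-m) * Real.exp (-1 * (F ω - m)) := by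
      intro ω; rw [← Real.exp_add]; congr 1; ring
    simp_rw [e]
    rw [integral_const_mul]
    refine mul_le_mul_of_nonneg_left (hMc.trans (le_of_eq ?_)) (Real.exp_pos _).le
    congr 1; rw [hA]; ring
  have hZpos : 0 < ∫ ω, Real.exp (-F ω) ∂μ := by
    rw [← hZ, hμ]
    exact integral_exp_neg_mul_pos (Λ := Λ) (contDiff_esAction U κ S₀ (m := 0)).continuous c
  rw [hZ]
  have hlog : Real.log (∫ ω, Real.exp (-F ω) ∂μ) ≤ -m + A / 8 := by
    rw [Real.log_le_iff_le_exp hZpos, Real.exp_add]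
    exact hexp
  have hgoal : m + Real.log (∫ ω, Real.exp (-F ω) ∂μ) ≤ A / 8 := by linarith
  simpa [hm, hA] using hgoal

/-- **THE EFFECTIVE SAMPLE SIZE OF THE UNCORRECTED LO FLOW IS AT LEAST `exp(−|Λ|·D²/2)` OF THE
NOMINAL ONE**: `exp(−|Λ|·D²/2)·∫ w² dπ̄ ≤ (∫ w dπ̄)²` for the importance weights
`w = exp(ℓ_{0→c} − c·S∘Φ_{0→c}) = e^{−S_eff}`, `D = (12κ²υ²/(d−1))·c²·e^{Kc}` (`∫w ≥ e^{−E S_eff}`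
by `e^x ≥ 1 + x`, `∫w² ≤ e^{−2E S_eff}·e^{|Λ|D²/2}` by McDiarmid at `t = −2`): the reweighting cost
is at most `|Λ|·D²/2` nats, linear in the volume and QUARTIC in the flow time. -/
theorem sq_integral_loWeight_ge_volume (hU0 : ∀ n, U n n = 0)
    (hUadj : ∀ m n (v w : E), ⟪U m n v, w⟫ = ⟪v, U n m w⟫) (hd : 2 ≤ Module.finrank ℝ E)
    (κ S₀ : ℝ) {υ : ℝ} (hυ : ∀ k, ∑ m, ‖U k m‖ ≤ υ) {c : ℝ} (hc0 : 0 ≤ c) (hc : c ≤ |T| + 1) :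
    Real.exp (-(Fintype.card Λ * (12 * κ ^ 2 * υ ^ 2 / ((Module.finrank ℝ E : ℝ) - 1) * c ^ 2 *
        Real.exp (3 * |κ| * υ / ((Module.finrank ℝ E : ℝ) - 1) * c)) ^ 2 / 2)) *
        ∫ ω, Real.exp (sphereTDFlowLogJac (G := fun _ : ℝ => loFlowAction κ S₀ U)
          (contDiff_const_family (contDiff_loFlowAction U κ S₀)) T 0 c
            (fun m => ((ω : Λ → sphere (0 : E) 1) m : E)) -
          c * esAction κ S₀ U (sphereTDFlow (G := fun _ : ℝ => loFlowAction κ S₀ U)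
            (contDiff_const_family (contDiff_loFlowAction U κ S₀)) T 0 c (fun m => (ω m : E)))) ^ 2
          ∂Measure.pi (fun _ : Λ => uniformSphere (volume : Measure E)) ≤
      (∫ ω, Real.exp (sphereTDFlowLogJac (G := fun _ : ℝ => loFlowAction κ S₀ U)
          (contDiff_const_family (contDiff_loFlowAction U κ S₀)) T 0 c
            (fun m => ((ω : Λ → sphere (0 : E) 1) m : E)) -
          c * esAction κ S₀ U (sphereTDFlow (G := fun _ : ℝ => loFlowAction κ S₀ U)
            (contDiff_const_family (contDiff_loFlowAction U κ S₀)) T 0 c (fun m => (ω m : E))))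
          ∂Measure.pi (fun _ : Λ => uniformSphere (volume : Measure E))) ^ 2 := by
  set μ : Measure (Λ → sphere (0 : E) 1) := Measure.pi (fun _ : Λ => uniformSphere (volume : Measure E))
    with hμ
  set F : (Λ → sphere (0 : E) 1) → ℝ := fun ω =>
    c * esAction κ S₀ U (sphereTDFlow (G := fun _ : ℝ => loFlowAction κ S₀ U)
        (contDiff_const_family (contDiff_loFlowAction U κ S₀)) T 0 c (fun m => (ω m : E))) -
      sphereTDFlowLogJac (G := fun _ : ℝ => loFlowAction κ S₀ U)
        (contDiff_const_family (contDiff_loFlowAction U κ S₀)) T 0 c (fun m => (ω m : E)) with hF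
  set A : ℝ := Fintype.card Λ * (12 * κ ^ 2 * υ ^ 2 / ((Module.finrank ℝ E : ℝ) - 1) * c ^ 2 *
    Real.exp (3 * |κ| * υ / ((Module.finrank ℝ E : ℝ) - 1) * c)) ^ 2 with hA
  set m : ℝ := ∫ ω, F ω ∂μ with hm
  have hFc : Continuous F := continuous_effAction_loFlow (U := U) κ S₀ c (T := T)
  have hFi : Integrable F μ := integrable_pi_of_continuous _ hFc
  -- rewrite the weights as `e^{−F}`
  have hw : ∀ ω : Λ → sphere (0 : E) 1,
      Real.exp (sphereTDFlowLogJac (G := fun _ : ℝ => loFlowAction κ S₀ U)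
          (contDiff_const_family (contDiff_loFlowAction U κ S₀)) T 0 c (fun m => (ω m : E)) -
        c * esAction κ S₀ U (sphereTDFlow (G := fun _ : ℝ => loFlowAction κ S₀ U)
          (contDiff_const_family (contDiff_loFlowAction U κ S₀)) T 0 c (fun m => (ω m : E)))) =
      Real.exp (-F ω) := by
    intro ω; simp only [hF, neg_sub]
  simp_rw [hw]
  -- lower bound on `∫ e^{−F}`: `≥ e^{−m}` since `e^{−(F − m)} ≥ 1 − (F − m)`
  have hlow : Real.exp (-m) ≤ ∫ ω, Real.exp (-F ω) ∂μ := by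
    have e : ∀ ω, Real.exp (-F ω) = Real.exp (-m) * Real.exp (-(F ω - m)) := by
      intro ω; rw [← Real.exp_add]; congr 1; ring
    simp_rw [e]
    rw [integral_const_mul]
    have hi : Integrable (fun ω => F ω - m) μ := hFi.sub (integrable_const m)
    have hi1 : Integrable (fun ω => 1 - (F ω - m)) μ := (integrable_const (1 : ℝ)).sub hi
    have h1 : ∫ ω, (1 - (F ω - m)) ∂μ ≤ ∫ ω, Real.exp (-(F ω - m)) ∂μ := by
      refine integral_mono hi1
        (integrable_pi_of_continuous _ (Real.continuous_exp.comp (hFc.sub continuous_const).neg))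
        fun ω => ?_
      have h := Real.add_one_le_exp (-(F ω - m))
      simp only
      linarith
    have hint1 : ∫ _ω, (1 : ℝ) ∂μ = 1 := by
      simp only [integral_const, smul_eq_mul, hμ, probReal_univ, one_mul]
    have hintF : ∫ ω, (F ω - m) ∂μ = 0 := by
      rw [integral_sub hFi (integrable_const m), integral_const, smul_eq_mul, hμ, probReal_univ,
        one_mul, ← hμ, ← hm, sub_self]
    have h2 : ∫ ω, (1 - (F ω - m)) ∂μ = 1 := by
      rw [integral_sub (integrable_const (1 : ℝ)) hi, hint1, hintF, sub_zero]
    rw [h2] at h1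
    calc Real.exp (-m) = Real.exp (-m) * 1 := (mul_one _).symm
      _ ≤ Real.exp (-m) * ∫ ω, Real.exp (-(F ω - m)) ∂μ :=
          mul_le_mul_of_nonneg_left h1 (Real.exp_pos _).le
  -- upper bound on `∫ e^{−2F}` by McDiarmid at `t = −2`
  have hMc := integral_exp_mul_effAction_loFlow_sub_le hU0 hUadj hd κ S₀ hυ hc0 hc (-2) (T := T)
  rw [← hμ] at hMc
  have hup : ∫ ω, Real.exp (-F ω) ^ 2 ∂μ ≤ Real.exp (-(2 * m)) * Real.exp (A / 2) := by
    have e : ∀ ω, Real.exp (-F ω) ^ 2 = Real.exp (-(2 * m)) * Real.exp (-2 * (F ω - m)) := by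
      intro ω; rw [sq, ← Real.exp_add, ← Real.exp_add]; congr 1; ring
    simp_rw [e]
    rw [integral_const_mul]
    refine mul_le_mul_of_nonneg_left (hMc.trans (le_of_eq ?_)) (Real.exp_pos _).le
    congr 1; rw [hA]; ring
  -- combine
  have hIpos : 0 ≤ ∫ ω, Real.exp (-F ω) ∂μ := le_trans (Real.exp_pos _).le hlow
  calc Real.exp (-(A / 2)) * ∫ ω, Real.exp (-F ω) ^ 2 ∂μ
      ≤ Real.exp (-(A / 2)) * (Real.exp (-(2 * m)) * Real.exp (A / 2)) :=
        mul_le_mul_of_nonneg_left hup (Real.exp_pos _).le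
    _ = Real.exp (-m) * Real.exp (-m) := by
        rw [← Real.exp_add, ← Real.exp_add, ← Real.exp_add]; congr 1; ring
    _ ≤ (∫ ω, Real.exp (-F ω) ∂μ) * ∫ ω, Real.exp (-F ω) ∂μ :=
        mul_le_mul hlow hlow (Real.exp_pos _).le hIpos
    _ = (∫ ω, Real.exp (-F ω) ∂μ) ^ 2 := by ring

end Summit.Ventures.LatticeQCDFlow.Exactness

end
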